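import Summits.QuantumFields.YangMills.Theses.ConvexGribovBody

/-!
# Sketch — crux-ideate round 1, ideator 1, crux `ConvexGribovBody.BrascampLiebVacuumSC`
(stmt-QuantumFields-16404)

First lemmas of the two idea cards filed by this seat (signatures only; `sorry` bodies; every
constant `lean search`-ed). Nothing here restates the crux.

* Card `coupling-flow-lipschitz-transport`:
  `slicePoincare_of_dirichletContraction` — a measure-preserving map `Φ` from the Wilson measure at
  coupling `β'` (where a 4d Poincaré inequality w.r.t. the metric-slope Dirichlet form over ALL links
  is available, e.g. Shen–Zhu–Zhu's regime) to the Wilson measure at `β`, which contracts the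
  metric-slope carré du champ by a factor `Lf²`, transports the inequality to `β`; restricted to
  admissible slice functions it is the crux's inequality shape with constant `κ' Lf²` in place of
  `C · Dmax`.  `calibration_ratio_le` — the one-line real inequality behind the Gaussian calibration
  `Lip² = max_p ω'_p/ω_p ≤ (2 max_p ω'_p) · Dmax`, `Dmax = max_p 1/(2ω_p)`.
* Card `up-slice-restriction`:
  `sliceDir_of_heatBath` — a heat-bath (Glauber) Poincaré inequality for the 4d Wilson measure
  (the `UP(β)` shape of route FradkinShenkerFlow) plus a one-link Poincaré constant `κ₁` for the
  tilted one-link laws gives the metric-slope inequality `Var ≤ 2 C κ₁ · dir` for slice functions;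
  `dmax_floor` — the volume-uniform lower bound `Dmax(β,S) ≥ d(β) > 0` that converts any
  `Var ≤ K(β) · dir` into the crux's `Var ≤ C · Dmax · dir` (necessary for the crux anyway, by the
  disprover's `ratio_le_of_inner` and a plaquette test function).
-/

noncomputable section

open scoped BigOperators Topology Matrix
open Filter MeasureTheory
open Literature.MathematicalPhysics.QuantumFieldTheory

namespace Summit.QuantumFields.YangMills.Cruxes.BrascampLiebVacuumSC.SketchIdeator1

variable {G : Type} [Group G] [TopologicalSpace G] [IsTopologicalGroup G] [CompactSpace G]
  [MeasurableSpace G] [BorelSpace G]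

/-- **Card 1, first lemma (transport of a Poincaré inequality to the slice).**
If `Φ` pushes `μ_{β'}` forward to `μ_β` on the torus `(2S+1)⁴` and contracts the metric-slope
carré du champ, `∑ₑ slopeₑ(F∘Φ)(U)² ≤ Lf² ∑ₑ slopeₑ(F)(Φ U)²` (the a.e. chain rule
`|∇(F∘Φ)| ≤ ‖DΦ‖_op |∇F|∘Φ` for an `Lf`-Lipschitz `Φ` in the product Frobenius metric), and `μ_{β'}`
satisfies a Poincaré inequality with constant `κ'` w.r.t. the Dirichlet form over ALL links, then
every admissible slice function satisfies `Var_{μ_β} f ≤ κ' · Lf² · dir f` (slice links only, because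
the slope of a slice function in any other link vanishes).  Pure measure theory (change of
variables under `Measure.map`); M-sized. [folklore] -/
theorem slicePoincare_of_dirichletContraction (r : LatticeRep G) (β β' κ' Lf : ℝ) (S : ℕ)
    (Φ : GaugeConfig 4 (2 * S + 1) G → GaugeConfig 4 (2 * S + 1) G) (hΦ : Measurable Φ)
    (hpush : (wilsonMeasure (d := 4) (L := 2 * S + 1) r.ρ β').map Φ =
      wilsonMeasure (d := 4) (L := 2 * S + 1) r.ρ β) :
    let μ := wilsonMeasure (d := 4) (L := 2 * S + 1) r.ρ β
    let μ' := wilsonMeasure (d := 4) (L := 2 * S + 1) r.ρ β'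
    let fro : Matrix (Fin r.N) (Fin r.N) ℂ → ℝ := fun M => ∑ a, ∑ b, ‖M a b‖ ^ 2
    let slope : (GaugeConfig 4 (2 * S + 1) G → ℝ) → GaugeConfig 4 (2 * S + 1) G →
        Edge 4 (2 * S + 1) → ℝ := fun f U e =>
      Filter.limsup (fun g : G => |f (Function.update U e g) - f U| /
        Real.sqrt (fro (r.ρ g - r.ρ (U e)))) (𝓝[≠] (U e))
    let dir : (GaugeConfig 4 (2 * S + 1) G → ℝ) → ℝ := fun f =>
      ∑ e : Edge 4 (2 * S + 1), (if e.1 0 = 0 ∧ e.2 ≠ 0 then ∫ U, (slope f U e) ^ 2 ∂μ else 0)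
    -- (a) Poincaré inequality at the base coupling β' for the FULL metric-slope Dirichlet form
    (∀ F : GaugeConfig 4 (2 * S + 1) G → ℝ, Measurable F →
      (∃ K : ℝ, ∀ U V : GaugeConfig 4 (2 * S + 1) G,
        |F U - F V| ≤ K * ∑ e, Real.sqrt (fro (r.ρ (U e) - r.ρ (V e)))) →
      ∫ U, (F U - ∫ V, F V ∂μ') ^ 2 ∂μ' ≤ κ' * ∑ e : Edge 4 (2 * S + 1), ∫ U, (slope F U e) ^ 2 ∂μ') →
    -- (b) Φ contracts the carré du champ by Lf² and preserves the Lipschitz class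
    (∀ F : GaugeConfig 4 (2 * S + 1) G → ℝ, ∀ U : GaugeConfig 4 (2 * S + 1) G,
      ∑ e : Edge 4 (2 * S + 1), (slope (F ∘ Φ) U e) ^ 2 ≤
        Lf ^ 2 * ∑ e : Edge 4 (2 * S + 1), (slope F (Φ U) e) ^ 2) →
    (∃ KΦ : ℝ, ∀ U V : GaugeConfig 4 (2 * S + 1) G,
      ∑ e, Real.sqrt (fro (r.ρ (Φ U e) - r.ρ (Φ V e))) ≤
        KΦ * ∑ e, Real.sqrt (fro (r.ρ (U e) - r.ρ (V e)))) →
    -- conclusion: the crux's inequality SHAPE at β with constant κ' · Lf² (Dmax enters via dmax_floor)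
    ∀ f : GaugeConfig 4 (2 * S + 1) G → ℝ, IsGaugeInvariant f →
      (∀ U V : GaugeConfig 4 (2 * S + 1) G,
        (∀ e : Edge 4 (2 * S + 1), e.1 0 = 0 → e.2 ≠ 0 → U e = V e) → f U = f V) →
      (∃ K : ℝ, ∀ U V : GaugeConfig 4 (2 * S + 1) G,
        |f U - f V| ≤ K * ∑ e, Real.sqrt (fro (r.ρ (U e) - r.ρ (V e)))) →
      ∫ U, (f U - ∫ V, f V ∂μ) ^ 2 ∂μ ≤ κ' * Lf ^ 2 * dir f := by
  sorry

/-- **Card 1, Gaussian calibration (the real inequality behind `Lip² ≤ 2ω'_max · Dmax`).**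
For the free lattice field the coupling-flow / linear transport from single-mode energies `ω'_p`
(short correlation length) to `ω_p ≤ ω'_p` has `Lip² = max_p ω'_p/ω_p`, and
`ω'_p/ω_p ≤ (max ω') · (max 1/ω) = 2 (max ω') · Dmax` with `Dmax = max_p 1/(2ω_p)`. [folklore] -/
theorem calibration_ratio_le {ι : Type*} [Fintype ι] [Nonempty ι] (ω ω' : ι → ℝ)
    (hω : ∀ p, 0 < ω p) (hω' : ∀ p, 0 < ω' p) (p : ι) :
    ω' p / ω p ≤ (2 * Finset.univ.sup' Finset.univ_nonempty ω') *
      Finset.univ.sup' Finset.univ_nonempty (fun q => 1 / (2 * ω q)) := by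
  sorry

/-- **Card 2, first lemma (heat-bath ⇒ metric-slope, and restriction to the slice).**
A heat-bath (Glauber) Poincaré inequality for `μ_β` on the torus — the `UP(β)` shape of
`FradkinShenkerFlow.SusceptibilityToPoincare`'s conclusion, one-link laws
`ν_ℓ^U ∝ e^{-β S_W(U[ℓ↦g])} dHaar(g)` — together with a one-link Poincaré constant `κ₁` valid for
every tilted one-link law (Holley–Stroock from the Haar Poincaré inequality: `κ₁ ≤ κ_Haar e^{2β·osc}`,
fine per β) yields `Var_μ f ≤ 2 C κ₁ · dir f` for admissible slice functions (DLR consistency of the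
one-link laws + vanishing slopes off the slice). M-sized. [folklore] -/
theorem sliceDir_of_heatBath (r : LatticeRep G) (β C κ₁ : ℝ) (S : ℕ) :
    let μ := wilsonMeasure (d := 4) (L := 2 * S + 1) r.ρ β
    let ν : GaugeConfig 4 (2 * S + 1) G → Edge 4 (2 * S + 1) → Measure G := fun U ℓ =>
      (haarProbability G).tilted (fun g' => -β * wilsonAction r.ρ (Function.update U ℓ g'))
    let fro : Matrix (Fin r.N) (Fin r.N) ℂ → ℝ := fun M => ∑ a, ∑ b, ‖M a b‖ ^ 2
    let slope : (GaugeConfig 4 (2 * S + 1) G → ℝ) → GaugeConfig 4 (2 * S + 1) G →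
        Edge 4 (2 * S + 1) → ℝ := fun f U e =>
      Filter.limsup (fun g : G => |f (Function.update U e g) - f U| /
        Real.sqrt (fro (r.ρ g - r.ρ (U e)))) (𝓝[≠] (U e))
    let dir : (GaugeConfig 4 (2 * S + 1) G → ℝ) → ℝ := fun f =>
      ∑ e : Edge 4 (2 * S + 1), (if e.1 0 = 0 ∧ e.2 ≠ 0 then ∫ U, (slope f U e) ^ 2 ∂μ else 0)
    -- UP(β): heat-bath Poincaré for all bounded measurable F
    (∀ F : GaugeConfig 4 (2 * S + 1) G → ℝ, Measurable F → (∃ M : ℝ, ∀ U, |F U| ≤ M) →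
      ProbabilityTheory.variance F μ ≤
        C * ∑ ℓ : Edge 4 (2 * S + 1), ∫ U, ∫ g, (F U - F (Function.update U ℓ g)) ^ 2 ∂(ν U ℓ) ∂μ) →
    -- one-link Poincaré, uniformly in the background, for link-Lipschitz F
    (∀ F : GaugeConfig 4 (2 * S + 1) G → ℝ,
      (∃ K : ℝ, ∀ U V : GaugeConfig 4 (2 * S + 1) G,
        |F U - F V| ≤ K * ∑ e, Real.sqrt (fro (r.ρ (U e) - r.ρ (V e)))) →
      ∀ (U : GaugeConfig 4 (2 * S + 1) G) (ℓ : Edge 4 (2 * S + 1)),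
        ∫ g, (F (Function.update U ℓ g) - ∫ g', F (Function.update U ℓ g') ∂(ν U ℓ)) ^ 2 ∂(ν U ℓ) ≤
          κ₁ * ∫ g, (slope F (Function.update U ℓ g) ℓ) ^ 2 ∂(ν U ℓ)) →
    ∀ f : GaugeConfig 4 (2 * S + 1) G → ℝ, IsGaugeInvariant f →
      (∀ U V : GaugeConfig 4 (2 * S + 1) G,
        (∀ e : Edge 4 (2 * S + 1), e.1 0 = 0 → e.2 ≠ 0 → U e = V e) → f U = f V) →
      (∃ K : ℝ, ∀ U V : GaugeConfig 4 (2 * S + 1) G,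
        |f U - f V| ≤ K * ∑ e, Real.sqrt (fro (r.ρ (U e) - r.ρ (V e)))) →
      ∫ U, (f U - ∫ V, f V ∂μ) ^ 2 ∂μ ≤ 2 * C * κ₁ * dir f := by
  sorry

/-- **Card 2 (and Card 1), the floor lemma `Dmax(β,S) ≥ d(β) > 0` uniformly in the volume.**
`Dmax ≥ (2S+1)⁻³ ∑ₚ ∫ sup_{h∈argmin} cov(U,h,p) ≥ ∫ sup_{h∈argmin} (link-average of ∑ⱼ ‖A_j^h‖²_F)`
(sup ≥ mean over `p`; `∑ₚ sup ≥ sup ∑ₚ`; Parseval over the spatial torus), and the minimal-Coulomb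
anti-Hermitian parts cannot vanish on average at fixed β (else all time-zero spatial plaquettes
would be trivial, against the local DLR lower bound `E[N − Re tr ρ(U_p)] ≥ a(β) > 0`; the delicate
point is to exclude gauge-fixed links with eigenphases near `π`, where `‖A‖_F` is small although the
link is far from `1` — maximality of the Coulomb functional under local/centre moves).  Needed by
EVERY proof of the crux (the crux and a plaquette test function force it, `ratio_le_of_inner`).
L-sized. [folklore] -/
theorem dmax_floor (hG : IsCompactSimpleLieGroup G) (r : LatticeRep G) :
    ∃ β₀ : ℝ, ∀ β : ℝ, β₀ ≤ β → ∃ d : ℝ, 0 < d ∧ ∃ S₀ : ℕ, ∀ S : ℕ, S₀ ≤ S →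
    let μ := wilsonMeasure (d := 4) (L := 2 * S + 1) r.ρ β
    let fro : Matrix (Fin r.N) (Fin r.N) ℂ → ℝ := fun M => ∑ a, ∑ b, ‖M a b‖ ^ 2
    let coul : GaugeConfig 4 (2 * S + 1) G → (Site 4 (2 * S + 1) → G) → ℝ := fun U h =>
      -∑ e : Edge 4 (2 * S + 1),
        (if e.1 0 = 0 ∧ e.2 ≠ 0 then (r.ρ (gaugeTransform h U e)).trace.re else 0)
    let cov : GaugeConfig 4 (2 * S + 1) G → (Site 4 (2 * S + 1) → G) →
        (Fin 3 → ZMod (2 * S + 1)) → ℝ := fun U h p =>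
      (∑ j : Fin 3, fro (∑ y : Fin 3 → ZMod (2 * S + 1),
        Complex.exp (-(2 * Real.pi * Complex.I *
          (∑ i : Fin 3, ((p i).val : ℂ) * ((y i).val : ℂ)) / (2 * S + 1 : ℂ))) •
        ((1 / 2 : ℂ) • (r.ρ (gaugeTransform h U (Fin.cons (0 : ZMod (2 * S + 1)) y, j.succ)) -
          (r.ρ (gaugeTransform h U (Fin.cons (0 : ZMod (2 * S + 1)) y, j.succ)))ᴴ)))) /
        ((2 * S + 1 : ℝ) ^ 3)
    let Dmax : ℝ := ⨆ p : Fin 3 → ZMod (2 * S + 1),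
      ∫ U, (⨆ h : {h : Site 4 (2 * S + 1) → G // ∀ h', coul U h ≤ coul U h'}, cov U h.1 p) ∂μ
    d ≤ Dmax := by
  sorry

end Summit.QuantumFields.YangMills.Cruxes.BrascampLiebVacuumSC.SketchIdeator1

end
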